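import Literature.Analysis.UnboundedOperators.LinearizedBoltzmannWeightedAbsorption
import HarnessLib

/-!
# The sub-Gaussian Chapman–Enskog inverse of the linearised hard-sphere operator in `ℝ³`

For the linearised hard-sphere operator `L` around the normalised Maxwellian `M` of `ℝ³`
(`hardSphereLinearizedOp`, `M dv = stdGaussian`; CIP 1994 §7.2) the tree provides, for every bounded
continuous `g ⊥_M span {1, v, |v|²}`, a continuous `M`-orthogonal solution `ψ₀ ∈ L²(M dv)` of
`L ψ₀ = g` with the Gaussian growth `|ψ₀(v)| ≤ C₀ ‖g‖_∞ e^{|v|²/4}`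
(`exists_continuous_inverse_hardSphereLinearizedOp`). Here this growth is improved to
**`|ψ₀(v)| ≤ C(θ) ‖g‖_∞ e^{θ|v|²}` for every `0 < θ < 1/2`** (`exists_abs_le_mul_exp_of_fixedPoint`,
`exists_continuous_inverse_hardSphereLinearizedOp_subGaussian`): the weighted sup-norm theory of `L⁻¹`
(Grad 1963; Caflisch, CPAM 33 (1980); Guo, ARMA 197 (2010), Lemma 3) in the `M`-weighted picture,
i.e. for the weights `e^{-(1/4 - θ)|v|²}`-times-`M^{-1/2}` in the symmetric picture.

Proof: with the truncated weights `W_N = max (e^{θ|·|²}, e^{|·|²/4}/N)` the a-priori bound makes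
`m_N = sup |ψ₀| / W_N ≤ C₀ ‖g‖_∞ N` finite; the absorption step of
`LinearizedBoltzmannWeightedAbsorption` gives `|ψ₀|/W_N ≤ m_N/2 + D` off a fixed ball and the a-priori
bound gives it on the ball, so `m_N ≤ 2D` uniformly in `N`, and `N → ∞`.

What is NOT here: the borderline `θ = 0`. By `LinearizedBoltzmannOrthogonalInverseUnbounded` the
`M`-orthogonal solution is in general unbounded (it contains a non-trivial element of `span {v, |v|²}`),
so no choice of constants gives `θ = 0` for it; whether SOME bounded pre-image exists for every bounded
`g ⊥` invariants is a finer (open, as far as the tree knows) asymptotic question. No new definitions.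
-/

open MeasureTheory Metric Real Set Filter Topology ProbabilityTheory Module
open scoped InnerProductSpace ENNReal

namespace Literature.Analysis.UnboundedOperators

noncomputable section

open Literature.MathematicalPhysics.KineticTheory (collide sphereMeasure hardSphereKernel)
open Literature.Analysis.FluidPDE

/-- **Sub-Gaussian growth of the Chapman–Enskog inverse (a-priori estimate, `ℝ³`).** For every
`0 < θ < 1/2` there is `C = C(θ)` such that: if `ψ` is measurable with the Gaussian growth
`|ψ(x)| ≤ A e^{|x|²/4}`, `ψ ∈ L²(M dv)` with `‖ψ‖_{L²(M)} ≤ B`, `|g| ≤ b`, and `ψ` solves Grad's integral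
equation `ν ψ = ∫∫ B (ψ' + ψ_*' - ψ_*) dω dM_* - g` pointwise, then
`|ψ(v)| ≤ C (A + B + b) e^{θ|v|²}` for every `v`.
Proof (the weighted sup-norm scheme of Grad 1963 / Guo 2010, with a truncation making the a-priori bound
part of the weight): for `W_N = max (e^{θ|·|²}, e^{|·|²/4}/N)` the quantity `m_N = sup |ψ|/W_N ≤ A N` is
finite; by `abs_le_half_weight_add_of_fixedPoint` (`ν(v) ≥ s₀ |v|`) one has
`|ψ|/W_N ≤ m_N/2 + C₂ (B + b)` off the ball `|v| < R₀` and `|ψ| ≤ A e^{R₀²/4}` on it; hence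
`m_N ≤ m_N/2 + D`, `m_N ≤ 2D` uniformly in `N`, and `N → ∞`. [folklore] -/
theorem exists_abs_le_mul_exp_of_fixedPoint {θ : ℝ} (hθ0 : 0 < θ) (hθ : θ < 1 / 2) :
    ∃ C : ℝ, 0 < C ∧ ∀ (ψ g : EuclideanSpace ℝ (Fin 3) → ℝ) (A B b : ℝ), Measurable ψ →
      (∀ x, |ψ x| ≤ A * Real.exp (‖x‖ ^ 2 / 4)) →
      MemLp ψ 2 (stdGaussian (EuclideanSpace ℝ (Fin 3))) →
      (eLpNorm ψ 2 (stdGaussian (EuclideanSpace ℝ (Fin 3)))).toReal ≤ B →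
      (∀ v, |g v| ≤ b) →
      (∀ v, collisionFrequency v * ψ v =
        (∫ w, ∫ ω, hardSphereKernel (v, w) ω * (ψ (collide ω (v, w)).1 + ψ (collide ω (v, w)).2 - ψ w)
          ∂sphereMeasure ∂stdGaussian (EuclideanSpace ℝ (Fin 3))) - g v) →
      ∀ v, |ψ v| ≤ C * (A + B + b) * Real.exp (θ * ‖v‖ ^ 2) := by
  -- the constants
  obtain ⟨Kθ, hKθ0, hKθ⟩ := exists_lintegral_gain_fst_gaussWeight_le hθ0 hθ
  obtain ⟨K4, hK40, hK4⟩ := exists_lintegral_gain_fst_gaussWeight_le (θ := 1 / 4) (by norm_num) (by norm_num)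
  obtain ⟨s₀, hs₀, hsν⟩ := exists_pos_mul_norm_le_collisionFrequency (E := EuclideanSpace ℝ (Fin 3)) (by simp)
  obtain ⟨ν₀, hν₀, hν₀le⟩ := exists_pos_le_collisionFrequency (E := EuclideanSpace ℝ (Fin 3)) (by simp)
  set C₂ : ℝ := (sphereMeasure : Measure (sphere (0 : EuclideanSpace ℝ (Fin 3)) 1)).real univ *
    (((∫⁻ w, ENNReal.ofReal ((1 + ‖w‖) ^ 2) ∂stdGaussian (EuclideanSpace ℝ (Fin 3))) ^ (1 / 2 : ℝ)).toReal) *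
      (1 / ν₀ + 1 / s₀) + 1 / ν₀ with hC₂
  have hC₂0 : 0 ≤ C₂ := by
    have : 0 ≤ (sphereMeasure : Measure (sphere (0 : EuclideanSpace ℝ (Fin 3)) 1)).real univ := measureReal_nonneg
    positivity
  set R₀ : ℝ := Real.sqrt (4 * (Kθ + K4) / s₀) + 1 with hR₀
  have hR₀1 : 1 ≤ R₀ := by rw [hR₀]; linarith [Real.sqrt_nonneg (4 * (Kθ + K4) / s₀)]
  have hR₀sq : 4 * (Kθ + K4) / s₀ ≤ R₀ ^ 2 := by
    have h := Real.sq_sqrt (show 0 ≤ 4 * (Kθ + K4) / s₀ by positivity)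
    rw [hR₀]; nlinarith [Real.sqrt_nonneg (4 * (Kθ + K4) / s₀)]
  set E₀ : ℝ := Real.exp (R₀ ^ 2 / 4) with hE₀
  refine ⟨2 * (C₂ + E₀), by positivity, fun ψ g A B b hψm hψA hψ2 hB hgb hfix => ?_⟩
  have hA0 : 0 ≤ A := by
    have h := hψA 0
    rw [norm_zero] at h
    norm_num at h
    exact (abs_nonneg _).trans h
  have hB0 : 0 ≤ B := ENNReal.toReal_nonneg.trans hB
  have hb0 : 0 ≤ b := (abs_nonneg _).trans (hgb 0)
  set D : ℝ := C₂ * (B + b) + A * E₀ with hD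
  -- the estimate with the truncated weight, uniformly in `N`
  have key : ∀ N : ℝ, 0 < N → ∀ y,
      |ψ y| ≤ 2 * D * max (Real.exp (θ * ‖y‖ ^ 2)) (Real.exp ((1 / 4 : ℝ) * ‖y‖ ^ 2) / N) := by
    intro N hN
    set W : EuclideanSpace ℝ (Fin 3) → ℝ := fun y =>
      max (Real.exp (θ * ‖y‖ ^ 2)) (Real.exp ((1 / 4 : ℝ) * ‖y‖ ^ 2) / N) with hW
    have hW1 : ∀ y, 1 ≤ W y := fun y => le_max_of_le_left (Real.one_le_exp (by positivity))
    have hWpos : ∀ y, 0 < W y := fun y => one_pos.trans_le (hW1 y)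
    -- `m = sup |ψ| / W ≤ A N`
    have hTb : BddAbove (Set.range fun y => |ψ y| / W y) := by
      refine ⟨A * N, ?_⟩
      rintro _ ⟨y, rfl⟩
      rw [div_le_iff₀ (hWpos y)]
      have h4 : Real.exp (‖y‖ ^ 2 / 4) = N * (Real.exp ((1 / 4 : ℝ) * ‖y‖ ^ 2) / N) := by
        rw [show ‖y‖ ^ 2 / 4 = (1 / 4 : ℝ) * ‖y‖ ^ 2 by ring]; field_simp
      calc |ψ y| ≤ A * Real.exp (‖y‖ ^ 2 / 4) := hψA y
        _ = A * N * (Real.exp ((1 / 4 : ℝ) * ‖y‖ ^ 2) / N) := by rw [h4]; ring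
        _ ≤ A * N * W y := mul_le_mul_of_nonneg_left (le_max_right _ _) (by positivity)
    set m : ℝ := sSup (Set.range fun y => |ψ y| / W y) with hm
    have hle_m : ∀ y, |ψ y| / W y ≤ m := fun y => le_csSup hTb ⟨y, rfl⟩
    have hm0 : 0 ≤ m := (div_nonneg (abs_nonneg _) (hWpos 0).le).trans (hle_m 0)
    have hdom : ∀ y, |ψ y| ≤ m * W y := fun y => by
      have := hle_m y; rwa [div_le_iff₀ (hWpos y)] at this
    -- the pointwise improvement `|ψ y| / W y ≤ m/2 + D`
    have himp : ∀ y, |ψ y| / W y ≤ m / 2 + D := by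
      intro y
      rw [div_le_iff₀ (hWpos y)]
      rcases lt_or_ge ‖y‖ R₀ with hy | hy
      · -- on the ball: the a-priori bound
        have h2 : |ψ y| ≤ A * E₀ := by
          refine (hψA y).trans (mul_le_mul_of_nonneg_left (Real.exp_le_exp.2 ?_) hA0)
          have := pow_le_pow_left₀ (norm_nonneg y) hy.le 2
          linarith
        have h3 : A * E₀ ≤ (m / 2 + D) * W y := by
          have : A * E₀ ≤ m / 2 + D := by
            rw [hD]; nlinarith [mul_nonneg hC₂0 (add_nonneg hB0 hb0)]
          exact this.trans (le_mul_of_one_le_right (by positivity) (hW1 y))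
        exact h2.trans h3
      · -- off the ball: absorption
        have hy0 : y ≠ 0 := by
          intro h; rw [h, norm_zero] at hy; linarith
        have hy4 : 4 * (Kθ + K4) ≤ s₀ * ‖y‖ ^ 2 := by
          have := (div_le_iff₀' hs₀).1 hR₀sq
          have h2 : s₀ * R₀ ^ 2 ≤ s₀ * ‖y‖ ^ 2 :=
            mul_le_mul_of_nonneg_left (pow_le_pow_left₀ (by linarith) hy 2) hs₀.le
          linarith
        have h := abs_le_half_weight_add_of_fixedPoint hψm hψ2 hN hm0 hKθ0 hK40 hB0 hb0 hs₀ hν₀ hdom hB hy0 hy4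
          (hsν y).1 (hν₀le y) (hgb y) (hKθ y hy0) (hK4 y hy0) (hfix y)
        rw [← hC₂] at h
        have hC₂W : C₂ * (B + b) ≤ D * W y := by
          have : C₂ * (B + b) ≤ D := by rw [hD]; nlinarith [mul_nonneg hA0 (Real.exp_nonneg (R₀ ^ 2 / 4))]
          exact this.trans (le_mul_of_one_le_right ((mul_nonneg hC₂0 (add_nonneg hB0 hb0)).trans this) (hW1 y))
        calc |ψ y| ≤ m / 2 * W y + C₂ * (B + b) := h
          _ ≤ m / 2 * W y + D * W y := add_le_add le_rfl hC₂W
          _ = (m / 2 + D) * W y := by ring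
    -- `m ≤ m/2 + D`, hence `m ≤ 2D`
    have hm_le : m ≤ m / 2 + D := csSup_le ⟨_, ⟨0, rfl⟩⟩ (by rintro _ ⟨y, rfl⟩; exact himp y)
    have hm2 : m ≤ 2 * D := by linarith
    intro y
    exact (hdom y).trans (mul_le_mul_of_nonneg_right hm2 (hWpos y).le)
  -- `N → ∞`
  intro v
  have hN : 0 < Real.exp ((1 / 4 : ℝ) * ‖v‖ ^ 2) := Real.exp_pos _
  have h := key _ hN v
  rw [div_self hN.ne', max_eq_left (Real.one_le_exp (by positivity))] at h
  refine h.trans (mul_le_mul_of_nonneg_right ?_ (Real.exp_nonneg _))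
  rw [hD]
  nlinarith [mul_nonneg hC₂0 hA0, mul_nonneg (Real.exp_nonneg (R₀ ^ 2 / 4)) (add_nonneg hB0 hb0)]

/-! ### The sub-Gaussian Chapman–Enskog inverse -/

/-- **The sub-Gaussian Chapman–Enskog inverse of the linearised hard-sphere operator in `ℝ³`.** There
are an absolute constant `λ > 0` (the spectral gap) and constants `C(θ) > 0` such that every bounded
continuous `g` on `ℝ³` which is `M`-orthogonal to the collision invariants `span {1, v, |v|²}` has a
continuous pre-image `ψ₀` under the linearised hard-sphere operator, `L ψ₀ (v) = g(v)` at every `v`, with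
`ψ₀ ∈ L²(M dv)`, `λ ‖ψ₀‖_{L²(M)} ≤ ‖g‖_{L²(M)}`, `ψ₀ ⊥_M` the collision invariants, and the growth bound
**`|ψ₀(v)| ≤ C(θ) ‖g‖_∞ e^{θ|v|²}` simultaneously for all `0 < θ < 1/2`** — Grad's / Guo's weighted
sup-norm theory (Grad 1963, Caflisch 1980, Guo 2010 Lemma 3) down to, but excluding, the borderline
`θ = 0`: by `LinearizedBoltzmannOrthogonalInverseUnbounded` this `M`-orthogonal `ψ₀` is in general
NOT bounded (`θ = 0` fails), its true growth being that of the collision invariants it must contain.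
Assembly of `exists_continuous_inverse_hardSphereLinearizedOp` (existence with growth `e^{|v|²/4}`)
and the a-priori estimate `exists_abs_le_mul_exp_of_fixedPoint`.
[cite: CIPDiluteGases1994, §7.2 Thm 7.2.1 and Thm 7.2.5] -/
theorem exists_continuous_inverse_hardSphereLinearizedOp_subGaussian :
    ∃ (lam : ℝ) (C : ℝ → ℝ), 0 < lam ∧ (∀ θ, 0 < C θ) ∧
      ∀ (g : EuclideanSpace ℝ (Fin 3) → ℝ) (b : ℝ), Continuous g → (∀ v, |g v| ≤ b) →
      (∀ φ ∈ collisionInvariants (EuclideanSpace ℝ (Fin 3)), maxwellianInner g φ = 0) →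
      ∃ ψ₀ : EuclideanSpace ℝ (Fin 3) → ℝ, Continuous ψ₀ ∧
        (∀ θ, 0 < θ → θ < 1 / 2 → ∀ v, |ψ₀ v| ≤ C θ * b * Real.exp (θ * ‖v‖ ^ 2)) ∧
        MemLp ψ₀ 2 (stdGaussian (EuclideanSpace ℝ (Fin 3))) ∧
        lam * (eLpNorm ψ₀ 2 (stdGaussian (EuclideanSpace ℝ (Fin 3)))).toReal ≤
          (eLpNorm g 2 (stdGaussian (EuclideanSpace ℝ (Fin 3)))).toReal ∧
        (∀ φ ∈ collisionInvariants (EuclideanSpace ℝ (Fin 3)), maxwellianInner ψ₀ φ = 0) ∧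
        ∀ v, hardSphereLinearizedOp ψ₀ v = g v := by
  obtain ⟨lam, C₀, hlam, hC₀, hex⟩ := exists_continuous_inverse_hardSphereLinearizedOp
  -- the constants `C(θ)`, uniform in `g`
  have hc : ∀ θ : ℝ, ∃ C : ℝ, 0 < C ∧ (0 < θ → θ < 1 / 2 →
      ∀ (ψ g : EuclideanSpace ℝ (Fin 3) → ℝ) (A B b : ℝ), Measurable ψ →
      (∀ x, |ψ x| ≤ A * Real.exp (‖x‖ ^ 2 / 4)) →
      MemLp ψ 2 (stdGaussian (EuclideanSpace ℝ (Fin 3))) →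
      (eLpNorm ψ 2 (stdGaussian (EuclideanSpace ℝ (Fin 3)))).toReal ≤ B →
      (∀ v, |g v| ≤ b) →
      (∀ v, collisionFrequency v * ψ v =
        (∫ w, ∫ ω, hardSphereKernel (v, w) ω * (ψ (collide ω (v, w)).1 + ψ (collide ω (v, w)).2 - ψ w)
          ∂sphereMeasure ∂stdGaussian (EuclideanSpace ℝ (Fin 3))) - g v) →
      ∀ v, |ψ v| ≤ C * (A + B + b) * Real.exp (θ * ‖v‖ ^ 2)) := by
    intro θ
    by_cases h : 0 < θ ∧ θ < 1 / 2
    · obtain ⟨C, hC, hCb⟩ := exists_abs_le_mul_exp_of_fixedPoint h.1 h.2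
      exact ⟨C, hC, fun _ _ => hCb⟩
    · exact ⟨1, one_pos, fun h1 h2 => (h ⟨h1, h2⟩).elim⟩
  choose C hCpos hC using hc
  refine ⟨lam, fun θ => C θ * (C₀ + 1 / lam + 1), hlam, fun θ => by have := hCpos θ; positivity,
    fun g b hg hb horth => ?_⟩
  obtain ⟨ψ₀, hcont, hgrowth, hmem, hnorm, horth', hL⟩ := hex g b hg hb horth
  refine ⟨ψ₀, hcont, fun θ hθ0 hθ v => ?_, hmem, hnorm, horth', hL⟩
  have hb0 : 0 ≤ b := (abs_nonneg _).trans (hb 0)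
  have hψm : Measurable ψ₀ := hcont.measurable
  -- the fixed-point form of `L ψ₀ = g`
  have hfix : ∀ v, collisionFrequency v * ψ₀ v =
      (∫ w, ∫ ω, hardSphereKernel (v, w) ω * (ψ₀ (collide ω (v, w)).1 + ψ₀ (collide ω (v, w)).2 - ψ₀ w)
        ∂sphereMeasure ∂stdGaussian (EuclideanSpace ℝ (Fin 3))) - g v := by
    intro v
    have h := hardSphereLinearizedOp_eq_kernel_sub_of_gaussGrowth hψm hgrowth v
    rw [hL v] at h
    linarith
  -- the `L²` bound `‖ψ₀‖ ≤ b / λ`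
  have hB : (eLpNorm ψ₀ 2 (stdGaussian (EuclideanSpace ℝ (Fin 3)))).toReal ≤ b / lam := by
    rw [le_div_iff₀ hlam, mul_comm]
    have hb0 : 0 ≤ b := (abs_nonneg _).trans (hb 0)
    have hg2 : (eLpNorm g 2 (stdGaussian (EuclideanSpace ℝ (Fin 3)))).toReal ≤ b := by
      have h := eLpNorm_le_of_ae_bound (p := 2) (μ := stdGaussian (EuclideanSpace ℝ (Fin 3))) (f := g) (C := b)
        (Eventually.of_forall fun v => by rw [Real.norm_eq_abs]; exact hb v)
      simp only [measure_univ, ENNReal.one_rpow, one_mul] at h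
      exact (ENNReal.toReal_mono ENNReal.ofReal_ne_top h).trans (by rw [ENNReal.toReal_ofReal hb0])
    exact hnorm.trans hg2
  have h := hC θ hθ0 hθ ψ₀ g (C₀ * b) (b / lam) b hψm hgrowth hmem hB hb hfix v
  refine h.trans (le_of_eq ?_)
  field_simp

end

end Literature.Analysis.UnboundedOperators
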